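import Summits.PneNP.PneNP.Theorems.RamseyUncertifiableResolutionUncertaintyPinMonotone
import Summits.PneNP.PneNP.Theorems.RamseyUncertifiableResolutionUncertaintyTreeLikeRung
import Summits.PneNP.PneNP.Theorems.RamseyUncertifiableResolutionUncertaintyTreeLikeUncertainty

/-!
# PIN-MONOTONE refutations, III: `PinMonotoneCoreHardness` and the pin-monotone rungs — item stmt-PneNP-9816
# `RamseyUncertifiable.ResolutionUncertainty` (support)

Consequences of `pinMonotone_cliqueCNF_length_ge_card_cliqueFinset` (file II: pin-monotone resolution refutations of
the unary `Clique(G,k)` have `≥ #t-cliques` lines, dag-like, no tree-likeness):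

* `pinMonotoneCoreHardness` — the typed sub-target `PinMonotoneCoreHardness` of the line `box-dag-self-gadget-lifting`
  (Cruxes/ResolutionUncertainty/Lines/box-dag-self-gadget-lifting.lean), verbatim, PROVED: on a two-sidedly bi-dense `H`
  (disjoint-pair density `≥ δ` at scale `m^{1-β}`) every pin-monotone refutation of `Clique(H,k)` has length
  `≥ m^{ε log₂ m}` (via `pow_le_factorial_mul_card_cliqueFinset` on `S = univ` and the numerics of …TreeLikeRung.lean).
  So the line's lever `BiDenseCoreHardness` — hence the item — can only fail through refutations that DROP PINS into
  non-initial premises (parking-type steps); the whole open problem lives there.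
* `pinMonotone_resolutionUncertainty` — the item for pin-monotone `π₁` (any `π₂`): `n^{ε log₂ n} ≤ |π₁|` for `n ≥ n₀`
  (Prömel–Rödl core route, as in …TreeLikeRung.lean).
* `pinMonotone_uncertainty` — every graph, explicit: `n ≥ 2^22`, pin-monotone `π₁, π₂` ⇒ `n^{(log₂ n)/9} ≤ max`
  (Erdős–Szekeres route, as in …TreeLikeUncertainty.lean).
-/

set_option linter.dupNamespace false

namespace Summit.PneNP.PneNP.Theorems.RamseyUncertifiableResolutionUncertainty

open Literature.Computability.Complexity Literature.Computability.MetaComplexity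
open Summit.PneNP.PneNP.Theorems.RegularResolutionRung.Negative (cliqueCNF)

/-- **`PinMonotoneCoreHardness` — the typed sub-target of the line `box-dag-self-gadget-lifting`, PROVED.** The
lever `BiDenseCoreHardness` of that line (hypothesis of `resolutionUncertainty_of_biDenseCoreHardness`) restricted
to PIN-MONOTONE refutations: two-sided disjoint-pair `δ`-density at scale `m^{1-β}` forces every pin-monotone
resolution refutation of the unary `Clique(H, k)` (any `k`) to have length `≥ m^{ε log₂ m}`, `ε = ε(β, δ) > 0`.
(Only the density of `H` itself is used; `k` and the bound `k ≤ 3 log₂ m` are irrelevant.) Statement verbatim the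
line's `PinMonotoneCoreHardness` with its `IsPinMonotone`. -/
theorem pinMonotoneCoreHardness :
    ∀ β δ : ℝ, 0 < β → β < 1 → 0 < δ →
      ∃ ε : ℝ, 0 < ε ∧ ∃ m₀ : ℕ, ∀ m : ℕ, m₀ ≤ m → ∀ k : ℕ, (k : ℝ) ≤ 3 * Real.logb 2 m →
        ∀ (H : SimpleGraph (Fin m)) [DecidableRel H.Adj],
          (∀ A B : Finset (Fin m), Disjoint A B → (m : ℝ) ^ (1 - β) ≤ A.card → (m : ℝ) ^ (1 - β) ≤ B.card →
            δ ≤ (H.edgeDensity A B : ℝ) ∧ δ ≤ (Hᶜ.edgeDensity A B : ℝ)) →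
          ∀ π : List (ResLine ℕ), IsResRefutation (cliqueCNF m k fun u v => decide (H.Adj u v)) π →
            IsPinMonotone π → (m : ℝ) ^ (ε * Real.logb 2 m) ≤ π.length := by
  intro β δ₀ hβ0 hβ1 hδ₀
  set δ : ℝ := min δ₀ 1 with hδdef
  have hδ0 : 0 < δ := lt_min hδ₀ one_pos
  have hδ1 : δ ≤ 1 := min_le_right _ _
  have hδle : δ ≤ δ₀ := min_le_left _ _
  set a : ℝ := Real.logb 2 (4 / δ) with ha
  have ha2 : 2 ≤ a := two_le_logb_four_div hδ0 hδ1
  set c : ℝ := β / (2 * a) with hc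
  have hc0 : 0 < c := by positivity
  set Λ : ℝ := max (6 / β) (max (16 * c / (3 * (1 - β) ^ 2 * (Real.log 2) ^ 2)) (2 / c)) with hΛ
  obtain ⟨S₀, hS₀2, hS₀⟩ := exists_threshold Λ
  set ε : ℝ := (1 - β) * c / 4 with hε
  have hε0 : 0 < ε := by
    have : 0 < 1 - β := by linarith
    positivity
  refine ⟨ε, hε0, S₀, ?_⟩
  intro m hm k _ H inst hdense π hπ hmono
  have hm2 : 2 ≤ m := le_trans hS₀2 hm
  have hm0 : (0 : ℝ) < m := by exact_mod_cast lt_of_lt_of_le (by norm_num) hm2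
  have hΛm : Λ ≤ Real.logb 2 m := hS₀ m hm
  have hL1 : 6 / β ≤ Real.logb 2 m := le_trans (le_max_left _ _) hΛm
  have hL2 : 16 * c / (3 * (1 - β) ^ 2 * (Real.log 2) ^ 2) ≤ Real.logb 2 m :=
    le_trans (le_trans (le_max_left _ _) (le_max_right _ _)) hΛm
  have hL3 : 2 / c ≤ Real.logb 2 m := le_trans (le_trans (le_max_right _ _) (le_max_right _ _)) hΛm
  -- scale and levels, on `S = univ` (`s = m`)
  set M : ℕ := ⌈(m : ℝ) ^ (1 - β)⌉₊ with hMdef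
  have hM1 : 1 ≤ M := by
    rw [hMdef, Nat.one_le_ceil_iff]
    exact Real.rpow_pos_of_pos hm0 _
  set T : ℕ := ⌊c * Real.logb 2 m⌋₊ with hTdef
  have hcL0 : 0 ≤ c * Real.logb 2 m :=
    mul_nonneg hc0.le (Real.logb_nonneg one_lt_two (by exact_mod_cast le_trans (by norm_num) hm2))
  have hTle : (T : ℝ) ≤ c * Real.logb 2 m := Nat.floor_le hcL0
  have hTge : c * Real.logb 2 m - 1 ≤ T := by
    have := Nat.lt_floor_add_one (c * Real.logb 2 m)
    rw [← hTdef] at this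
    linarith
  have hdenseM : ∀ A ⊆ (Finset.univ : Finset (Fin m)), ∀ B ⊆ (Finset.univ : Finset (Fin m)), Disjoint A B →
      M ≤ A.card → M ≤ B.card → δ ≤ (H.edgeDensity A B : ℝ) := by
    intro A _ B _ hAB hMA hMB
    have hA' : (m : ℝ) ^ (1 - β) ≤ A.card := le_trans (Nat.le_ceil _) (by exact_mod_cast hMA)
    have hB' : (m : ℝ) ^ (1 - β) ≤ B.card := le_trans (Nat.le_ceil _) (by exact_mod_cast hMB)
    exact hδle.trans (hdense A B hAB hA' hB').1
  have hcardU : ((Finset.univ : Finset (Fin m)).card : ℝ) = m := by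
    rw [Finset.card_univ, Fintype.card_fin]
  have hroom : (4 * M : ℝ) ≤ (δ / 4) ^ T * (Finset.univ : Finset (Fin m)).card := by
    rw [hcardU]; exact room_of_large hβ0 hβ1 hδ0 hδ1 hm2 hTle hL1
  have hcount := pow_le_factorial_mul_card_cliqueFinset H Finset.univ M T δ hδ0 (by linarith) hM1 hdenseM hroom
  have hpm := pinMonotone_cliqueCNF_length_ge_card_cliqueFinset H π T hπ hmono
  have hlev : (T : ℝ) ≤ 3 * Real.sqrt M := by
    rw [hMdef]; exact levels_of_large hβ1 hm2 hTle hL2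
  have hexp := exponent_of_count hβ1 hc0 hm2 rfl hcount hlev hTge hL3
  -- `m^{ε log₂ m} = 2^{ε (log₂ m)²}`
  calc (m : ℝ) ^ (ε * Real.logb 2 m) = (2 : ℝ) ^ ((1 - β) * c / 4 * Real.logb 2 m ^ 2) := by
        rw [rpow_eq_two_rpow hm0, hε]; ring_nf
    _ ≤ ((H.cliqueFinset T).card : ℝ) := hexp
    _ ≤ π.length := by exact_mod_cast hpm

/-- **The item for PIN-MONOTONE refutations (proved).** There are `ε > 0` and `n₀` such that for every graph `G` on
`n ≥ n₀` vertices, every pin-monotone resolution refutation `π₁` of the unary `Clique(G, ⌈log₂ n²⌉)` has length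
`≥ n^{ε log₂ n}` as soon as `Clique(Gᶜ, ⌈log₂ n²⌉)` has any resolution refutation. Same proof as
`treeLike_resolutionUncertainty` with `pinMonotone_cliqueCNF_length_ge_card_cliqueFinset`. -/
theorem pinMonotone_resolutionUncertainty :
    ∃ ε : ℝ, 0 < ε ∧ ∃ n₀ : ℕ, ∀ n ≥ n₀, ∀ (G : SimpleGraph (Fin n)) [DecidableRel G.Adj],
      ∀ π₁ π₂ : List (ResLine ℕ),
        IsResRefutation (cliqueCNF n (Nat.clog 2 (n ^ 2)) fun u v => decide (G.Adj u v)) π₁ → IsPinMonotone π₁ →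
        IsResRefutation (cliqueCNF n (Nat.clog 2 (n ^ 2)) fun u v => decide (Gᶜ.Adj u v)) π₂ →
        (n : ℝ) ^ (ε * Real.logb 2 n) ≤ π₁.length := by
  -- the core
  obtain ⟨β, δ₀, hβ0, hβ1, hδ₀, n₁, hcore⟩ := stub_promelRodl stub_drcStep
  set δ : ℝ := min δ₀ 1 with hδdef
  have hδ0 : 0 < δ := lt_min hδ₀ one_pos
  have hδ1 : δ ≤ 1 := min_le_right _ _
  have hδle : δ ≤ δ₀ := min_le_left _ _
  -- constants
  set a : ℝ := Real.logb 2 (4 / δ) with ha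
  have ha2 : 2 ≤ a := two_le_logb_four_div hδ0 hδ1
  set c : ℝ := β / (2 * a) with hc
  have hc0 : 0 < c := by positivity
  set Λ : ℝ := max (6 / β) (max (16 * c / (3 * (1 - β) ^ 2 * (Real.log 2) ^ 2)) (2 / c)) with hΛ
  obtain ⟨S₀, hS₀2, hS₀⟩ := exists_threshold Λ
  set ε' : ℝ := (1 - β) * c / 4 with hε'
  have hε'0 : 0 < ε' := by
    have : 0 < 1 - β := by linarith
    positivity
  refine ⟨9 / 16 * ε', by positivity, max n₁ (S₀ ^ 2), ?_⟩
  intro n hn G inst π₁ π₂ h₁ hmono h₂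
  have hn₁ : n₁ ≤ n := le_trans (le_max_left _ _) hn
  have hnS : S₀ ^ 2 ≤ n := le_trans (le_max_right _ _) hn
  have hn4 : 4 ≤ n := le_trans (by nlinarith) hnS
  have hn1 : (1 : ℝ) ≤ n := by exact_mod_cast le_trans (by norm_num) hn4
  have hnpos : (0 : ℝ) < n := by linarith
  set k : ℕ := Nat.clog 2 (n ^ 2) with hk
  -- soundness on both sides, then the core
  have hfree : G.CliqueFree k := cliqueFree_of_refutation G h₁
  have hfreeC : Gᶜ.CliqueFree k := cliqueFree_of_refutation Gᶜ h₂
  obtain ⟨S, hS, hdense⟩ := hcore n hn₁ G hfree hfreeC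
  set s : ℕ := S.card with hsdef
  -- `s ≥ S₀`
  have hsS₀ : S₀ ≤ s := by
    have h1 : ((S₀ : ℝ)) ≤ (n : ℝ) ^ ((1 : ℝ) / 2) := by
      rw [← Real.sqrt_eq_rpow, Real.le_sqrt (by positivity) (by positivity)]
      exact_mod_cast hnS
    have h2 : (n : ℝ) ^ ((1 : ℝ) / 2) ≤ (n : ℝ) ^ ((3 : ℝ) / 4) :=
      Real.rpow_le_rpow_of_exponent_le hn1 (by norm_num)
    exact_mod_cast (h1.trans h2).trans hS
  have hs2 : 2 ≤ s := le_trans hS₀2 hsS₀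
  have hs0 : (0 : ℝ) < s := by exact_mod_cast lt_of_lt_of_le (by norm_num) hs2
  have hΛs : Λ ≤ Real.logb 2 s := hS₀ s hsS₀
  have hL1 : 6 / β ≤ Real.logb 2 s := le_trans (le_max_left _ _) hΛs
  have hL2 : 16 * c / (3 * (1 - β) ^ 2 * (Real.log 2) ^ 2) ≤ Real.logb 2 s :=
    le_trans (le_trans (le_max_left _ _) (le_max_right _ _)) hΛs
  have hL3 : 2 / c ≤ Real.logb 2 s := le_trans (le_trans (le_max_right _ _) (le_max_right _ _)) hΛs
  -- scale, levels
  set M : ℕ := ⌈(s : ℝ) ^ (1 - β)⌉₊ with hMdef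
  have hM1 : 1 ≤ M := by
    rw [hMdef, Nat.one_le_ceil_iff]
    exact Real.rpow_pos_of_pos hs0 _
  set T : ℕ := ⌊c * Real.logb 2 s⌋₊ with hTdef
  have hcL0 : 0 ≤ c * Real.logb 2 s :=
    mul_nonneg hc0.le (Real.logb_nonneg one_lt_two (by exact_mod_cast le_trans (by norm_num) hs2))
  have hTle : (T : ℝ) ≤ c * Real.logb 2 s := Nat.floor_le hcL0
  have hTge : c * Real.logb 2 s - 1 ≤ T := by
    have := Nat.lt_floor_add_one (c * Real.logb 2 s)
    rw [← hTdef] at this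
    linarith
  -- density at scale `M` (one-sided) inside `S`
  have hdenseM : ∀ A ⊆ S, ∀ B ⊆ S, Disjoint A B → M ≤ A.card → M ≤ B.card → δ ≤ (G.edgeDensity A B : ℝ) := by
    intro A hA B hB hAB hMA hMB
    have hA' : (S.card : ℝ) ^ (1 - β) ≤ A.card := le_trans (Nat.le_ceil _) (by exact_mod_cast hMA)
    have hB' : (S.card : ℝ) ^ (1 - β) ≤ B.card := le_trans (Nat.le_ceil _) (by exact_mod_cast hMB)
    exact hδle.trans (hdense A hA B hB hAB hA' hB').1
  -- room and the count
  have hroom : (4 * M : ℝ) ≤ (δ / 4) ^ T * S.card := room_of_large hβ0 hβ1 hδ0 hδ1 hs2 hTle hL1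
  have hcount := pow_le_factorial_mul_card_cliqueFinset G S M T δ hδ0 (by linarith) hM1 hdenseM hroom
  -- pin-monotone refutations enumerate cliques
  have htl := pinMonotone_cliqueCNF_length_ge_card_cliqueFinset G π₁ T h₁ hmono
  -- numerics
  have hlev : (T : ℝ) ≤ 3 * Real.sqrt M := by
    rw [hMdef]; exact levels_of_large hβ1 hs2 hTle hL2
  have hexp := exponent_of_count hβ1 hc0 hs2 rfl hcount hlev hTge hL3
  -- `n^{(9/16) ε' log₂ n} ≤ 2^{ε' (log₂ s)²}`
  have hx0 : 0 ≤ Real.logb 2 n := Real.logb_nonneg one_lt_two hn1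
  have h34 : 3 / 4 * Real.logb 2 n ≤ Real.logb 2 s := by
    have := Real.logb_le_logb_of_le (b := 2) one_lt_two (by positivity) hS
    rwa [Real.logb_rpow_eq_mul_logb_of_pos hnpos] at this
  have hmain : (n : ℝ) ^ (9 / 16 * ε' * Real.logb 2 n) ≤ (2 : ℝ) ^ (ε' * Real.logb 2 s ^ 2) := by
    rw [rpow_eq_two_rpow hnpos]
    refine Real.rpow_le_rpow_of_exponent_le one_le_two ?_
    have : Real.logb 2 n * (9 / 16 * ε' * Real.logb 2 n) = ε' * (3 / 4 * Real.logb 2 n) ^ 2 := by ring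
    rw [this]
    refine mul_le_mul_of_nonneg_left ?_ hε'0.le
    exact pow_le_pow_left₀ (by positivity) h34 2
  calc (n : ℝ) ^ (9 / 16 * ε' * Real.logb 2 n) ≤ (2 : ℝ) ^ (ε' * Real.logb 2 s ^ 2) := hmain
    _ ≤ ((G.cliqueFinset T).card : ℝ) := by rw [hε']; exact hexp
    _ ≤ π₁.length := by exact_mod_cast htl

/-- **Pin-monotone uncertainty, every graph, explicit exponent.** For `n ≥ 2^22`, every graph `G` on `Fin n`, all
`k₁ k₂`, and all PIN-MONOTONE resolution refutations `π₁` of `Clique(G, k₁)` and `π₂` of `Clique(Gᶜ, k₂)`: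
`max(|π₁|, |π₂|) ≥ n^{(log₂ n)/9}`. Same proof as `treeLike_uncertainty`. -/
theorem pinMonotone_uncertainty :
    ∀ (n : ℕ), 2 ^ 22 ≤ n → ∀ (G : SimpleGraph (Fin n)) [DecidableRel G.Adj] (k₁ k₂ : ℕ) (π₁ π₂ : List (ResLine ℕ)),
      IsResRefutation (cliqueCNF n k₁ fun u v => decide (G.Adj u v)) π₁ → IsPinMonotone π₁ →
      IsResRefutation (cliqueCNF n k₂ fun u v => decide (Gᶜ.Adj u v)) π₂ → IsPinMonotone π₂ →
        (n : ℝ) ^ (Real.logb 2 n / 9) ≤ max (π₁.length : ℝ) (π₂.length : ℝ) := by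
  intro n hn G _ k₁ k₂ π₁ π₂ h₁ ht₁ h₂ ht₂
  set L := Real.logb 2 (n : ℝ) with hLdef
  set q : ℕ := ⌊L / 4⌋₊ + 1 with hqdef
  have hn1 : (1 : ℝ) ≤ n := by exact_mod_cast le_trans (by norm_num) (le_trans (Nat.one_le_two_pow) hn)
  have hnpos : (0 : ℝ) < n := by linarith
  have hL22 : 22 ≤ L := by
    have : (2 : ℝ) ^ (22 : ℝ) ≤ n := by
      rw [show (22 : ℝ) = ((22 : ℕ) : ℝ) by norm_num, Real.rpow_natCast]
      exact_mod_cast hn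
    have := Real.logb_le_logb_of_le (b := 2) one_lt_two (by positivity) this
    rwa [Real.logb_rpow two_pos (by norm_num)] at this
  have hcount := two_rpow_le_card_homogeneous G hn
  have hA : ((G.cliqueFinset q).card : ℝ) ≤ π₁.length := by exact_mod_cast pinMonotone_cliqueCNF_length_ge_card_cliqueFinset G π₁ q h₁ ht₁
  have hB : ((Gᶜ.cliqueFinset q).card : ℝ) ≤ π₂.length := by exact_mod_cast pinMonotone_cliqueCNF_length_ge_card_cliqueFinset Gᶜ π₂ q h₂ ht₂
  have hsum : (2 : ℝ) ^ (L ^ 2 / 8 - L / 4) ≤ 2 * max (π₁.length : ℝ) (π₂.length : ℝ) := by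
    calc (2 : ℝ) ^ (L ^ 2 / 8 - L / 4) ≤ ((G.cliqueFinset q).card : ℝ) + ((Gᶜ.cliqueFinset q).card : ℝ) := hcount
      _ ≤ π₁.length + π₂.length := add_le_add hA hB
      _ ≤ 2 * max (π₁.length : ℝ) (π₂.length : ℝ) := by
          have := le_max_left (π₁.length : ℝ) (π₂.length : ℝ)
          have := le_max_right (π₁.length : ℝ) (π₂.length : ℝ)
          linarith
  -- `n^{L/9} = 2^{L²/9} ≤ 2^{L²/8 - L/4 - 1} ≤ max`
  have hexp : L * (L / 9) ≤ L ^ 2 / 8 - L / 4 - 1 := by nlinarith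
  calc (n : ℝ) ^ (L / 9) = (2 : ℝ) ^ (L * (L / 9)) := by
        rw [← Real.rpow_logb two_pos (by norm_num) hnpos, ← Real.rpow_mul (by norm_num)]
    _ ≤ (2 : ℝ) ^ (L ^ 2 / 8 - L / 4 - 1) := Real.rpow_le_rpow_of_exponent_le one_le_two hexp
    _ = (2 : ℝ) ^ (L ^ 2 / 8 - L / 4) / 2 := by
        rw [Real.rpow_sub two_pos, Real.rpow_one]
    _ ≤ max (π₁.length : ℝ) (π₂.length : ℝ) := by linarith


end Summit.PneNP.PneNP.Theorems.RamseyUncertifiableResolutionUncertainty
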